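import Literature.NumberTheory.EllipticCurves.Sprung2012.LocalTowerNoPTorsionProofs
import Literature.NumberTheory.EllipticCurves.IwasawaTowerTorsionProofs
import Literature.NumberTheory.EllipticCurves.BSDSelmerCMPConverseHeegnerFieldProofs
import Literature.NumberTheory.EllipticCurves.NonEisensteinPrimeOfSurjective
import HarnessLib

/-!
# No `p`-torsion up the anticyclotomic tower, globally and locally — the two `H⁰`-inputs of the
# residual (mod `p`) Selmer comparison behind child 20399 `InvariantsTransportModThree`
# (route `UniversalToricDescent`, crux #2 `ToricTransportModThree`, stmt-BirchSwinnertonDyer-20186)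

Lead prover bsd-wall-utd-p1 g5 (`--supports stmt-BirchSwinnertonDyer-20399`, mechanism helper;
memo HOME/bsd-wall-utd-p1/PRICING-20399-ALG-HALF-utdp1g5.md §2 (G), (L)). Greenberg–Vatsal's
transport of Iwasawa invariants along `E′[p] ≅ E[p]` compares the residual Selmer groups over
`K_∞`; the two places where the CURVE (not just `E[p]`) enters are the global `H⁰`
`E(K_∞)[p]` (injectivity of `H¹(K_∞, E[p]) → H¹(K_∞, E[p^∞])[p]`) and the local `H⁰`
`E(K_{∞,w})[p]` at the strict places `w ∣ 𝔭′` (exactness of the pulled-back strict condition).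
Both vanish by Greenberg's fixed-point principle (a pro-`p` group acting on a non-zero finite
`p`-group fixes a non-zero point), given the vanishing over the BASE:

* §1 `localTowerPoints_eq_zero_of_prime_nsmul_of_base` — LOCAL, for ANY field `K`, ANY
  `ℤ_p`-extension `κ` of `K`, ANY `K`-field `E` of characteristic `0` (typically `E = K_v`) and any
  embedding `ι : K̄ → Ē`: if `E(E)[p] = 0` then `E(K_∞·E)[p] = 0`
  (`Sprung2012.localTowerPointsOfEmb κ ι W`). This is the tree's discharge of Sprung 2012 Lemma 2.3
  (`Sprung2012.eq_zero_of_mem_localTowerPointsOfEmb_of_prime_nsmul`: `K = ℚ`, good supersingular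
  `p`) with its one curve-specific step — `E(ℚ_p)[p] = 0` — turned into the hypothesis, so that it
  applies at an ADDITIVE prime and over the anticyclotomic tower of an imaginary quadratic field;
  `localTowerPoints_noPTorsion_iff_base`: the converse is trivial, so `E(K_∞·E)[p] = 0 ↔ E(E)[p] = 0`.
* §2 `fixedPoints_kerSubgroup_geomPrimaryTorsion_baseChange_eq_bot_of_surjective` — GLOBAL: for
  `W/ℚ` with `ρ̄_{W,p}` onto `GL₂(𝔽_p)`, `K` imaginary quadratic and ANY `ℤ_p`-extension `κ` of `K`,
  `E(K_∞)[p^∞] = 0` (the tree's `fixedPoints_kerSubgroup_geomPrimaryTorsion_eq_bot` for `W/K`, fed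
  by `E(K)[p] = 0` = `torsionBy_eq_bot_of_isImaginaryQuadratic_of_hasIrreducibleModPGaloisRep` and
  `hasIrreducibleModPGaloisRep_of_hasSurjectiveModNGaloisRep`).
* §3 the `p = 3` readings on the binders of 20186/20399/20395 (`W.HasSurjectiveModNGaloisRep 3`,
  `IsImaginaryQuadratic K`, `κ : ZpExtension K 3`).

Since both statements only see `E[p]` restricted to the relevant Galois group and a hypothesis on
the base, they hold VERBATIM for the mod-`p` twin `E′` under the same base hypothesis — the point
of the memo's §2. HONEST STATUS: mechanism lemmas; nothing of 20399/20395 is proved; no definition,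
no named fact, no `sorry`. BSD is not proved by any of this.

References: [GreenbergLNM1716] proof of Prop. 4.8 (p. 109); [Sprung2012] Lemma 2.3 (p. 1487);
[GreenbergVatsal2000] §2 (Prop. 2.8); [GrossLMS1991] §2; [Washington1997] §13.1.
-/

noncomputable section

open scoped Classical NumberField AddSubgroup

open NumberField IsDedekindDomain WeierstrassCurve Literature.NumberTheory.EllipticCurves
  Literature.NumberTheory.EllipticCurves.ZpExtension Literature.NumberTheory.EllipticCurves.Sprung2012

set_option linter.dupNamespace false
set_option autoImplicit false

universe u

namespace Summit.BirchSwinnertonDyer.BirchSwinnertonDyer.Theorems.UniversalToricDescentTowerTorsion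

/-! ## §1 Local: `E(E)[p] = 0 ⟹ E(K_∞·E)[p] = 0` for any `ℤ_p`-extension and any base field -/

section Local

variable {K : Type u} [Field K] {p : ℕ} [Fact p.Prime] (κ : ZpExtension K p)
  {E : Type u} [Field E] [Algebra K E] [CharZero E]
  (ι : AlgebraicClosure K →ₐ[K] AlgebraicClosure E) (W : WeierstrassCurve K) [W.IsElliptic]

omit [Fact p.Prime] [W.IsElliptic] in
/-- **Galois descent step**: a point of `E(Ē)` (`localPoints W E`) fixed by all of `Γ_E` and killed
by `p` is `O`, PROVIDED `E(E)[p] = 0` (`h0`, on the `E`-points of `W ×_K E`). Descent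
`exists_toGeomPoints_eq_of_forall_smul_eq` along `localPointsEquivBaseChange`; `E` perfect
(characteristic `0`). [cite: GreenbergLNM1716, proof of Prop. 4.8 (p. 109)] -/
theorem localPoints_eq_zero_of_forall_smul_eq_of_base
    (h0 : ∀ Q : (W.baseChange E).toAffine.Point, p • Q = 0 → Q = 0)
    {P : localPoints W E} (hfix : ∀ σ : Field.absoluteGaloisGroup E, σ • P = P) (hpP : p • P = 0) :
    P = 0 := by
  haveI : PerfectField E := by infer_instance
  set Q : geomPoints (W.baseChange E) := localPointsEquivBaseChange W E P with hQdef
  have hQ : ∀ σ : Field.absoluteGaloisGroup E, σ • Q = Q := fun σ ↦ by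
    rw [hQdef, ← localPointsEquivBaseChange_smul W E σ P, hfix σ]
  obtain ⟨P₀, hP₀⟩ :=
    WeierstrassCurve.exists_toGeomPoints_eq_of_forall_smul_eq (W.baseChange E) hQ
  have hP₀p : p • P₀ = 0 := by
    apply WeierstrassCurve.toGeomPoints_injective (W.baseChange E)
    rw [map_nsmul, hP₀, map_zero, hQdef, ← map_nsmul, hpP, map_zero]
  have hP₀0 : P₀ = 0 := h0 P₀ hP₀p
  have hQ0 : Q = 0 := by rw [← hP₀, hP₀0, map_zero]
  exact (localPointsEquivBaseChange W E).injective (by rw [← hQdef, hQ0, map_zero])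

/-- **`E(E)[p] = 0 ⟹ E(K_∞·E)[p] = 0`** (Greenberg's fixed-point principle, local form, any base).
For a field `K`, a `ℤ_p`-extension `κ` of `K` (`K_∞ = K̄^{ker κ}`), a `K`-field `E` of
characteristic `0` with an embedding `ι : K̄ → Ē`, and an elliptic curve `W/K`: if `W(E)` has no
point of order `p`, then no non-zero point of `E(K_∞·E) = localTowerPointsOfEmb κ ι W` (the points
of `W(Ē)` fixed by `Gal(Ē/K_∞·E) = localSubgroupOfEmb (ker κ) ι`) is killed by `p`. Proof =
the tree's proof of Sprung 2012 Lemma 2.3 with its supersingular step replaced by `h0`: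
`V = E(K_∞·E)[p]` is a finite `p`-group (`#W(Ē)[p] = p²`), `Γ_E` acts on it through a `p`-group
(`ZpExtension.isPGroup_range_of_localSubgroupOfEmb_le`: the image of `Γ_E` in `Gal(K_∞/K) ≅ ℤ_p`
has cyclic `p`-power finite quotients), the fixed points lie in `E(E)[p] = 0`
(`localPoints_eq_zero_of_forall_smul_eq_of_base`), so `#V ≡ 1 (mod p)` and `V = 0`. Intended use:
`K` imaginary quadratic, `κ` anticyclotomic, `E = K_𝔭′ ≅ ℚ_p` at a split `p`, `W` with ADDITIVE
reduction at `p` — no reduction hypothesis is needed. [cite: GreenbergLNM1716, proof of Prop. 4.8 (p. 109)]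
[cite: Sprung2012, Lemma 2.3 (p. 1487) (the case `K = ℚ`, `p` good supersingular)] -/
theorem localTowerPoints_eq_zero_of_prime_nsmul_of_base
    (h0 : ∀ Q : (W.baseChange E).toAffine.Point, p • Q = 0 → Q = 0)
    {P : localPoints W E} (hPmem : P ∈ localTowerPointsOfEmb κ ι W) (hpP : p • P = 0) : P = 0 := by
  have hp : p.Prime := Fact.out
  -- `V = E(K_∞·E)[p]`, a finite `Γ_E`-stable subgroup of `E(Ē)`
  set V : AddSubgroup (localPoints W E) :=
    localTowerPointsOfEmb κ ι W ⊓ (localPoints W E)[(p : ℕ)] with hV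
  have hpne : ((p : ℕ) : AlgebraicClosure E) ≠ 0 := by exact_mod_cast hp.ne_zero
  have hcard : Nat.card ((localPoints W E)[(p : ℕ)]) = p ^ 2 :=
    WeierstrassCurve.card_torsionPoints_eq_sq_holds W (AlgebraicClosure E) (n := p) hpne
  have hfinp : Finite ↥((localPoints W E)[(p : ℕ)]) :=
    Nat.finite_of_card_ne_zero (by rw [hcard]; exact pow_ne_zero 2 hp.ne_zero)
  haveI hVfin : Finite V :=
    Finite.of_injective _ (AddSubgroup.inclusion_injective (inf_le_right : V ≤ _))
  have hmemV : ∀ {x : localPoints W E}, x ∈ V ↔ x ∈ localTowerPointsOfEmb κ ι W ∧ p • x = 0 := by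
    intro x
    rw [hV, AddSubgroup.mem_inf, AddSubgroup.torsionBy.nsmul_iff]
  have hstab : ∀ (σ : Field.absoluteGaloisGroup E) (x : localPoints W E), x ∈ V → σ • x ∈ V := by
    intro σ x hx
    rw [hmemV] at hx ⊢
    refine ⟨smul_mem_localTowerPointsOfEmb κ ι W σ hx.1, ?_⟩
    rw [smul_comm, hx.2, smul_zero]
  -- the permutation action `ρ : Γ_E → Perm(V)`
  let ρ : Field.absoluteGaloisGroup E →* Equiv.Perm V :=
    { toFun := fun σ ↦
        { toFun := fun x ↦ ⟨σ • (x : localPoints W E), hstab σ _ x.2⟩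
          invFun := fun x ↦ ⟨σ⁻¹ • (x : localPoints W E), hstab σ⁻¹ _ x.2⟩
          left_inv := fun x ↦ Subtype.ext (inv_smul_smul σ (x : localPoints W E))
          right_inv := fun x ↦ Subtype.ext (smul_inv_smul σ (x : localPoints W E)) }
      map_one' := Equiv.ext fun x ↦ Subtype.ext (one_smul _ (x : localPoints W E))
      map_mul' := fun σ τ ↦ Equiv.ext fun x ↦ Subtype.ext (mul_smul σ τ (x : localPoints W E)) }
  have hρ : ∀ (σ : Field.absoluteGaloisGroup E) (x : V),
      ((ρ σ x : V) : localPoints W E) = σ • (x : localPoints W E) := fun _ _ ↦ rfl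
  -- `Gal(Ē/K_∞·E)` acts trivially (definition of the tower points): the range is a `p`-group
  have hker : localSubgroupOfEmb κ.kerSubgroup ι ≤ ρ.ker := by
    intro τ hτ
    rw [MonoidHom.mem_ker]
    refine Equiv.ext fun x ↦ Subtype.ext ?_
    rw [hρ, Equiv.Perm.coe_one, id_eq]
    exact (mem_localTowerPointsOfEmb_iff κ ι W _).mp (hmemV.mp x.2).1 τ hτ
  have hP : IsPGroup p ρ.range := κ.isPGroup_range_of_localSubgroupOfEmb_le ι ρ hker
  -- fixed points of the range on `V`: exactly `{0}`
  have hfp : MulAction.fixedPoints ρ.range V = {(0 : V)} := by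
    ext x
    simp only [Set.mem_singleton_iff, MulAction.mem_fixedPoints]
    constructor
    · intro hx
      have hall : ∀ σ : Field.absoluteGaloisGroup E,
          σ • (x : localPoints W E) = (x : localPoints W E) := fun σ ↦ by
        have h := hx ⟨ρ σ, MonoidHom.mem_range.mpr ⟨σ, rfl⟩⟩
        rw [Subgroup.mk_smul, Equiv.Perm.smul_def] at h
        have h' := congrArg (fun z : V ↦ (z : localPoints W E)) h
        simpa only [hρ] using h'
      have hx0 : (x : localPoints W E) = 0 :=
        localPoints_eq_zero_of_forall_smul_eq_of_base W h0 hall (hmemV.mp x.2).2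
      exact Subtype.ext (by rw [hx0, ZeroMemClass.coe_zero])
    · rintro rfl ⟨π, hπ⟩
      obtain ⟨σ, rfl⟩ := MonoidHom.mem_range.mp hπ
      rw [Subgroup.mk_smul, Equiv.Perm.smul_def]
      exact Subtype.ext (by rw [hρ, ZeroMemClass.coe_zero, smul_zero])
  -- `#V ≡ 1 (mod p)`
  have hmod : Nat.card V ≡ 1 [MOD p] := by
    have h := hP.card_modEq_card_fixedPoints V
    have h1 : Nat.card (({0} : Set V) : Type _) = 1 := Nat.card_unique
    rwa [hfp, h1] at h
  -- `#V` is a power of `p`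
  have hPV : IsPGroup p (Multiplicative V) := fun g ↦ ⟨1, by
    rw [pow_one]
    change Multiplicative.ofAdd (p • (Multiplicative.toAdd g)) = Multiplicative.ofAdd 0
    congr 1
    exact Subtype.ext (by
      rw [AddSubmonoidClass.coe_nsmul, ZeroMemClass.coe_zero]
      exact (hmemV.mp (Multiplicative.toAdd g).2).2)⟩
  obtain ⟨n, hn⟩ := IsPGroup.iff_card.mp hPV
  have hnV : Nat.card V = p ^ n := hn
  -- hence `n = 0` and `V` is trivial
  have hn0 : n = 0 := by
    by_contra hne
    have hdvd : p ∣ Nat.card V := hnV ▸ dvd_pow_self p hne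
    have h : Nat.card V % p = 1 % p := hmod
    rw [Nat.mod_eq_zero_of_dvd hdvd, Nat.mod_eq_of_lt hp.one_lt] at h
    exact zero_ne_one h
  rw [hn0, pow_zero] at hnV
  haveI hsub : Subsingleton V := (Nat.card_eq_one_iff_unique.mp hnV).1
  have hPV' : P ∈ V := hmemV.mpr ⟨hPmem, hpP⟩
  have h := congrArg Subtype.val (Subsingleton.elim (⟨P, hPV'⟩ : V) ⟨0, V.zero_mem⟩)
  exact h

omit [CharZero E] [W.IsElliptic] in
/-- The points of `E(E)` map into the tower points `E(K_∞·E)` (an `E`-rational point is fixed by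
all of `Γ_E`). [folklore] -/
theorem toGeomPoints_mem_localTowerPointsOfEmb (Q : (W.baseChange E).toAffine.Point) :
    (localPointsEquivBaseChange W E).symm (WeierstrassCurve.toGeomPoints (W.baseChange E) Q) ∈
      localTowerPointsOfEmb κ ι W := by
  rw [mem_localTowerPointsOfEmb_iff]
  intro τ _
  apply (localPointsEquivBaseChange W E).injective
  rw [localPointsEquivBaseChange_smul, AddEquiv.apply_symm_apply,
    WeierstrassCurve.smul_toGeomPoints]

/-- **`E(K_∞·E)[p] = 0 ↔ E(E)[p] = 0`**: the converse of
`localTowerPoints_eq_zero_of_prime_nsmul_of_base` is the trivial inclusion `E(E) ⊆ E(K_∞·E)`.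
So the local `H⁰`-input of the residual comparison at `w ∣ 𝔭′` is a property of the BASE curve over
`E = K_𝔭′` — the same for every curve with the same `E`-points of order `p`, in particular decided
by `E[p]|_{Γ_E}` alone. [cite: GreenbergLNM1716, proof of Prop. 4.8 (p. 109)] -/
theorem localTowerPoints_noPTorsion_iff_base :
    (∀ P : localPoints W E, P ∈ localTowerPointsOfEmb κ ι W → p • P = 0 → P = 0) ↔
      ∀ Q : (W.baseChange E).toAffine.Point, p • Q = 0 → Q = 0 := by
  constructor
  · intro h Q hQ
    have hmem := toGeomPoints_mem_localTowerPointsOfEmb κ ι W Q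
    have hp0 : p • (localPointsEquivBaseChange W E).symm
        (WeierstrassCurve.toGeomPoints (W.baseChange E) Q) = 0 := by
      rw [← map_nsmul, ← map_nsmul, hQ, map_zero, map_zero]
    have h0 := h _ hmem hp0
    have h1 : WeierstrassCurve.toGeomPoints (W.baseChange E) Q = 0 := by
      have := congrArg (localPointsEquivBaseChange W E) h0
      rwa [AddEquiv.apply_symm_apply, map_zero] at this
    exact WeierstrassCurve.toGeomPoints_injective (W.baseChange E) (by rw [h1, map_zero])
  · intro h0 P hP hpP
    exact localTowerPoints_eq_zero_of_prime_nsmul_of_base κ ι W h0 hP hpP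

end Local

/-! ## §2 Global: `ρ̄_{W,p}` onto, `K` imaginary quadratic ⟹ `E(K_∞)[p^∞] = 0` for every `ℤ_p`-extension of `K` -/

section Global

variable (W : WeierstrassCurve ℚ) [W.IsElliptic] (p : ℕ) [Fact p.Prime]

/-- **`E(K)[p] = 0`** for `W/ℚ` with `ρ̄_{W,p} : Γ_ℚ → GL₂(𝔽_p)` surjective and `K` imaginary
quadratic: surjective ⟹ irreducible (`hasIrreducibleModPGaloisRep_of_hasSurjectiveModNGaloisRep`)
⟹ no `K`-rational `p`-torsion over a quadratic field
(`torsionBy_eq_bot_of_isImaginaryQuadratic_of_hasIrreducibleModPGaloisRep`, Gross 1991 §2).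
[cite: GrossLMS1991, §2 (sentence after (2.2))] -/
theorem baseChange_noPTorsion_of_surjective (hsurj : W.HasSurjectiveModNGaloisRep (p : ℤ))
    (K : Type u) [Field K] [NumberField K] (hK : IsImaginaryQuadratic K) :
    ∀ P : (W.baseChange K).toAffine.Point, p • P = 0 → P = 0 := by
  have hp : p.Prime := Fact.out
  haveI : NeZero (p : ℚ) := ⟨by exact_mod_cast hp.ne_zero⟩
  have hirr : W.HasIrreducibleModPGaloisRep p :=
    hasIrreducibleModPGaloisRep_of_hasSurjectiveModNGaloisRep W p hsurj
  have hbot := torsionBy_eq_bot_of_isImaginaryQuadratic_of_hasIrreducibleModPGaloisRep W K hK hp hirr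
  intro P hP
  have hmem : P ∈ AddSubgroup.torsionBy (W.baseChange K).toAffine.Point (p : ℤ) :=
    AddSubgroup.torsionBy.nsmul_iff.mpr hP
  rw [hbot] at hmem
  exact (AddSubgroup.mem_bot).mp hmem

/-- **`E(K_∞)[p^∞] = 0`**: for `W/ℚ` with `ρ̄_{W,p}` onto `GL₂(𝔽_p)`, `K` imaginary quadratic and
ANY `ℤ_p`-extension `κ` of `K` (anticyclotomic or not), the subgroup of `E(K̄)[p^∞]`
(`geomPrimaryTorsion (W.baseChange K) p`) fixed by `Gal(K̄/K_∞) = ker κ` is trivial — the tree's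
`fixedPoints_kerSubgroup_geomPrimaryTorsion_eq_bot` (Greenberg's fixed-point principle, global
form) fed by `baseChange_noPTorsion_of_surjective`. This is the global `H⁰`-input
(injectivity of `H¹(K_∞, E[p]) → H¹(K_∞, E[p^∞])`) of the residual Selmer comparison.
[cite: GreenbergLNM1716, proof of Prop. 4.8 (p. 109)] [cite: GreenbergVatsal2000, §2 (Prop. 2.8, the hypothesis `E(ℚ_∞)[p] = 0`)] -/
theorem fixedPoints_kerSubgroup_geomPrimaryTorsion_baseChange_eq_bot_of_surjective
    (hsurj : W.HasSurjectiveModNGaloisRep (p : ℤ))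
    (K : Type u) [Field K] [NumberField K] (hK : IsImaginaryQuadratic K) (κ : ZpExtension K p) :
    FixedPoints.addSubgroup κ.kerSubgroup (geomPrimaryTorsion (W.baseChange K) p) = ⊥ :=
  (W.baseChange K).fixedPoints_kerSubgroup_geomPrimaryTorsion_eq_bot κ
    (baseChange_noPTorsion_of_surjective W p hsurj K hK)

end Global

/-! ## §3 The readings at `p = 3` on the binders of 20186 / 20399 / 20395 -/

section Three

variable (W : WeierstrassCurve ℚ) [W.IsElliptic]

/-- **(G) of the memo at `p = 3`**: under the crux's binders `W.HasSurjectiveModNGaloisRep 3` and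
`IsImaginaryQuadratic K`, for every `κ : ZpExtension K 3` (in particular the anticyclotomic one),
`E(K_∞)[3^∞] = 0`. [cite: GreenbergLNM1716, proof of Prop. 4.8 (p. 109)] -/
theorem geomPrimaryTorsion_three_tower_eq_bot (hsurj : W.HasSurjectiveModNGaloisRep 3)
    (K : Type) [Field K] [NumberField K] (hK : IsImaginaryQuadratic K) (κ : ZpExtension K 3) :
    haveI : Fact (Nat.Prime 3) := ⟨Nat.prime_three⟩
    FixedPoints.addSubgroup κ.kerSubgroup (geomPrimaryTorsion (W.baseChange K) 3) = ⊥ := by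
  haveI : Fact (Nat.Prime 3) := ⟨Nat.prime_three⟩
  exact fixedPoints_kerSubgroup_geomPrimaryTorsion_baseChange_eq_bot_of_surjective W 3
    (by exact_mod_cast hsurj) K hK κ

/-- **(L) of the memo at `p = 3`**, at a prime `𝔭′ ∣ 3` of `K` (any `K`-embedding
`ι : K̄ → \overline{K_𝔭′}`; for `𝔭′` of degree one `K_𝔭′ ≅ ℚ₃`): `E(K_∞·K_𝔭′)[3] = 0 ↔ E(K_𝔭′)[3] = 0`
— the only local `H⁰`-input of the residual comparison at the strict places is a condition on the
base curve over `K_𝔭′`, with no reduction hypothesis (so it reads at the wild additive prime of the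
O6 class, and identically for a mod-3 congruent twin with the same `K_𝔭′`-rational 3-torsion).
[cite: GreenbergLNM1716, proof of Prop. 4.8 (p. 109)] [cite: Sprung2012, Lemma 2.3 (p. 1487)] -/
theorem localTowerPoints_noThreeTorsion_iff_base (K : Type) [Field K] [NumberField K]
    (κ : ZpExtension K 3) (𝔭' : HeightOneSpectrum (𝓞 K))
    (ι : AlgebraicClosure K →ₐ[K] AlgebraicClosure (𝔭'.adicCompletion K)) :
    haveI : Fact (Nat.Prime 3) := ⟨Nat.prime_three⟩
    (∀ P : localPoints (W.baseChange K) (𝔭'.adicCompletion K),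
        P ∈ localTowerPointsOfEmb κ ι (W.baseChange K) → 3 • P = 0 → P = 0) ↔
      ∀ Q : ((W.baseChange K).baseChange (𝔭'.adicCompletion K)).toAffine.Point, 3 • Q = 0 → Q = 0 := by
  haveI : Fact (Nat.Prime 3) := ⟨Nat.prime_three⟩
  haveI : CharZero (𝔭'.adicCompletion K) :=
    charZero_of_injective_algebraMap (algebraMap K _).injective
  exact localTowerPoints_noPTorsion_iff_base (p := 3) κ ι (W.baseChange K)

end Three

end Summit.BirchSwinnertonDyer.BirchSwinnertonDyer.Theorems.UniversalToricDescentTowerTorsion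

end
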